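import Summits.SmoothPoincare4.SmoothPoincare4.Theorems.EntropyRungConicalGapSecondWeightedIdentity
import Summits.SmoothPoincare4.SmoothPoincare4.Theorems.EntropyRungConicalGapScaleDerivatives
import HarnessLib

/-!
# Helper `helper_regularisedVolume_monotone` of line `Sketch`
(crux `EntropyRung.ConicalGap`, stmt-SmoothPoincare4-16589)

Wang–Wang 2023 (arXiv:2308.06560), Prop. 2.6, first statement, `n = 4`: on a complete connected
normalised gradient shrinking Ricci soliton `(M⁴, g, f)` (`Ric + Hess f = g/2`, `R + |∇f|² = f`,
closed `g`-balls compact) the regularised volume `H(τ) = τ⁻² ∫ e^{-f/τ} dV` (`= 16π² h(τ)` in the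
notation of Wang–Wang) is non-decreasing on `(0, 1]` and non-increasing on `[1, ∞)`.

Proof: with `Z(τ) = ∫ e^{-f/τ}`, `F(τ) = ∫ f e^{-f/τ}`, `N(τ) = ∫ R e^{-f/τ}` (all `dV`), the scale
derivative `Z′(τ) = τ⁻² F(τ)` (`scaleDerivatives_hasDerivAt`, weight `w = 1`, the weights being
integrable by `weightedIntegrability_riemVolume`) and the product rule give
`H′(τ) = τ⁻⁴ (F − 2τ Z) = τ⁻⁴ (1 − τ) N(τ)` by the first weighted identity `F − 2τ Z = (1 − τ) N`
(`secondWeightedIdentity_firstIdentity`). Since `R ≥ 0`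
(`NoncompactShrinkerGapCarrilloNiClauses.scalarCurvature_nonneg_and_isCompact_sublevel`), `N ≥ 0`,
so `H′ ≥ 0` on `(0, 1)` and `H′ ≤ 0` on `(1, ∞)`, and the mean value theorem
(`monotoneOn_of_hasDerivWithinAt_nonneg`, `antitoneOn_of_hasDerivWithinAt_nonpos`) concludes.

Everything here is proved; no definition and no named fact is introduced.

## References

* Y. Wang, G. Wang (Wang–Wang 2023), arXiv:2308.06560, Prop. 2.6, (2.7)–(2.10).
-/

noncomputable section

-- `Summit.SmoothPoincare4.SmoothPoincare4.…` (summit = problem) trips `dupNamespace` on every decl.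
set_option linter.dupNamespace false

open scoped Manifold ContDiff ENNReal NNReal Topology
open MeasureTheory Set Filter
open Literature.Geometry.Lorentzian Literature.Geometry.Riemannian

namespace Summit.SmoothPoincare4.SmoothPoincare4.Theorems.ConicalGapSketch

/-! ## Calculus: product rule and mean value theorem for `τ ↦ τ⁻² Z(τ)` -/

/-- Product rule: if `Z′(τ) = τ⁻² F` at `τ ≠ 0` and `F − 2τ Z(τ) = (1 − τ) N`, then
`(s ↦ s⁻² Z(s))′(τ) = τ⁻⁴ (1 − τ) N`. -/
theorem regularisedVolume_hasDerivAt_of (Z : ℝ → ℝ) {τ F N : ℝ} (hτ : τ ≠ 0)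
    (hZ : HasDerivAt Z ((τ ^ 2)⁻¹ * F) τ) (hid : F - 2 * τ * Z τ = (1 - τ) * N) :
    HasDerivAt (fun s : ℝ ↦ (s ^ 2)⁻¹ * Z s) ((τ ^ 4)⁻¹ * ((1 - τ) * N)) τ := by
  have h1 := (hasDerivAt_pow 2 τ).fun_inv (pow_ne_zero 2 hτ)
  refine (h1.fun_mul hZ).congr_deriv ?_
  rw [← hid]
  have h3 : ((2 : ℕ) : ℝ) * τ ^ (2 - 1) = 2 * τ := by norm_num
  rw [h3]
  field_simp
  ring

/-- Mean value theorem packaging: if `H′(τ) = τ⁻⁴ (1 − τ) N(τ)` at every `τ > 0` with `N ≥ 0` on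
`(0, ∞)`, then `H` is non-decreasing on `(0, 1]` and non-increasing on `[1, ∞)`. -/
theorem regularisedVolume_monotone_of_hasDerivAt (H N : ℝ → ℝ)
    (hD : ∀ τ : ℝ, 0 < τ → HasDerivAt H ((τ ^ 4)⁻¹ * ((1 - τ) * N τ)) τ)
    (hN : ∀ τ : ℝ, 0 < τ → 0 ≤ N τ) :
    MonotoneOn H (Ioc 0 1) ∧ AntitoneOn H (Ici 1) := by
  have hcont : ∀ s : Set ℝ, s ⊆ Ioi 0 → ContinuousOn H s :=
    fun s hs ↦ continuousOn_of_forall_continuousAt fun τ hτ ↦ (hD τ (hs hτ)).continuousAt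
  refine ⟨monotoneOn_of_hasDerivWithinAt_nonneg (f' := fun τ ↦ (τ ^ 4)⁻¹ * ((1 - τ) * N τ))
      (convex_Ioc 0 1) (hcont _ fun τ hτ ↦ hτ.1) (fun τ hτ ↦ ?_) (fun τ hτ ↦ ?_),
    antitoneOn_of_hasDerivWithinAt_nonpos (f' := fun τ ↦ (τ ^ 4)⁻¹ * ((1 - τ) * N τ))
      (convex_Ici 1) (hcont _ fun τ hτ ↦ mem_Ioi.2 (one_pos.trans_le hτ)) (fun τ hτ ↦ ?_)
      (fun τ hτ ↦ ?_)⟩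
  · rw [interior_Ioc] at hτ
    exact (hD τ hτ.1).hasDerivWithinAt
  · rw [interior_Ioc] at hτ
    have hτ0 : 0 < τ := hτ.1
    exact mul_nonneg (by positivity) (mul_nonneg (by linarith [hτ.2]) (hN τ hτ0))
  · rw [interior_Ici] at hτ
    exact (hD τ (one_pos.trans hτ)).hasDerivWithinAt
  · rw [interior_Ici] at hτ
    have hτ0 : 0 < τ := one_pos.trans hτ
    have hτ1 : 1 - τ ≤ 0 := by
      have : (1 : ℝ) < τ := hτ
      linarith
    exact mul_nonpos_of_nonneg_of_nonpos (by positivity)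
      (mul_nonpos_of_nonpos_of_nonneg hτ1 (hN τ hτ0))

/-! ## The regularised volume of a normalised 4-d gradient shrinker -/

section Integrated

variable {M : Type} [TopologicalSpace M] [T2Space M] [SecondCountableTopology M]
  [ChartedSpace (EuclideanSpace ℝ (Fin 4)) M] [IsManifold (𝓡 4) ∞ M] [ConnectedSpace M]
  [T3Space M] [MeasurableSpace M] [BorelSpace M]

/-- **Wang–Wang 2023, (2.10), `n = 4`, over `g.riemVolume`**: on a complete connected normalised 4-d
gradient shrinker, for every `τ > 0`, the regularised volume `H(s) = s⁻² ∫ e^{-f/s} dV` has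
derivative `H′(τ) = τ⁻⁴ (1 − τ) ∫ R e^{-f/τ} dV`: the scale derivative
`Z′(τ) = τ⁻² ∫ f e^{-f/τ}` (`scaleDerivatives_hasDerivAt` with weight `1`, integrability by
`weightedIntegrability_riemVolume` at `τ` and `2τ`), the product rule
(`regularisedVolume_hasDerivAt_of`) and the first weighted identity
(`secondWeightedIdentity_firstIdentity`). -/
theorem regularisedVolume_hasDerivAt
    (g : PseudoRiemannianMetric (𝓡 4) ∞ (EuclideanSpace ℝ (Fin 4)) (TangentSpace (𝓡 4) : M → Type _))
    [g.HasLeviCivita] (f : M → ℝ) (hg : g.IsRiemannian)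
    (hc : ∀ (x : M) (r : NNReal), IsCompact {y : M | g.edist hg x y ≤ r})
    (hf : ContMDiff (𝓡 4) 𝓘(ℝ, ℝ) ∞ f)
    (hsol : ∀ (x : M) (X Y : TangentSpace (𝓡 4) x),
      g.ricci x X Y + g.hessian f x X Y = (1 / 2 : ℝ) * g.val x X Y)
    (hnorm : ∀ x : M, g.scalarCurvature x + g.gradSq f x = f x) {τ : ℝ} (hτ : 0 < τ) :
    HasDerivAt (fun s : ℝ ↦ (s ^ 2)⁻¹ * ∫ x, Real.exp (-f x / s) ∂g.riemVolume)
      ((τ ^ 4)⁻¹ * ((1 - τ) * ∫ x, g.scalarCurvature x * Real.exp (-f x / τ) ∂g.riemVolume)) τ := by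
  obtain ⟨hR0, -, hprop⟩ :=
    NoncompactShrinkerGapCarrilloNiClauses.scalarCurvature_nonneg_and_isCompact_sublevel g f hg hc hf
      hsol hnorm
  have hf0 : ∀ x, 0 ≤ f x := fun x ↦ by linarith [hnorm x, hR0 x, g.gradSq_nonneg hg f x]
  obtain ⟨iZ, -, -⟩ := weightedIntegrability_riemVolume hg hf hsol hnorm hprop hR0 hτ
  obtain ⟨-, iF2, -⟩ :=
    weightedIntegrability_riemVolume hg hf hsol hnorm hprop hR0 (τ := 2 * τ) (by positivity)
  have hfm : Measurable f := hf.continuous.measurable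
  have h1 : Integrable (fun x ↦ (1 : ℝ) * Real.exp (-f x / τ)) g.riemVolume := by
    simpa only [one_mul] using iZ
  have hZ : HasDerivAt (fun s : ℝ ↦ ∫ x, Real.exp (-f x / s) ∂g.riemVolume)
      ((τ ^ 2)⁻¹ * ∫ x, f x * Real.exp (-f x / τ) ∂g.riemVolume) τ := by
    simpa only [one_mul] using
      scaleDerivatives_hasDerivAt (μ := g.riemVolume) (w := fun _ ↦ (1 : ℝ)) (g := f) hfm
        measurable_const hf0 (fun x ↦ one_mul (f x)) hτ h1 iF2
  exact regularisedVolume_hasDerivAt_of _ hτ.ne' hZ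
    (secondWeightedIdentity_firstIdentity g f hg hc hf hsol hnorm hτ)

/-- **Wang–Wang 2023, Prop. 2.6, first statement, `n = 4`, over `g.riemVolume`**: on a complete
connected normalised 4-d gradient shrinker the regularised volume `τ ↦ τ⁻² ∫ e^{-f/τ} dV` is
non-decreasing on `(0, 1]` and non-increasing on `[1, ∞)`: `regularisedVolume_hasDerivAt`,
`∫ R e^{-f/τ} dV ≥ 0` as `R ≥ 0`, and `regularisedVolume_monotone_of_hasDerivAt`. -/
theorem regularisedVolume_monotone_riemVolume
    (g : PseudoRiemannianMetric (𝓡 4) ∞ (EuclideanSpace ℝ (Fin 4)) (TangentSpace (𝓡 4) : M → Type _))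
    [g.HasLeviCivita] (f : M → ℝ) (hg : g.IsRiemannian)
    (hc : ∀ (x : M) (r : NNReal), IsCompact {y : M | g.edist hg x y ≤ r})
    (hf : ContMDiff (𝓡 4) 𝓘(ℝ, ℝ) ∞ f)
    (hsol : ∀ (x : M) (X Y : TangentSpace (𝓡 4) x),
      g.ricci x X Y + g.hessian f x X Y = (1 / 2 : ℝ) * g.val x X Y)
    (hnorm : ∀ x : M, g.scalarCurvature x + g.gradSq f x = f x) :
    MonotoneOn (fun τ : ℝ ↦ (τ ^ 2)⁻¹ * ∫ x, Real.exp (-f x / τ) ∂g.riemVolume) (Ioc 0 1) ∧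
      AntitoneOn (fun τ : ℝ ↦ (τ ^ 2)⁻¹ * ∫ x, Real.exp (-f x / τ) ∂g.riemVolume) (Ici 1) := by
  obtain ⟨hR0, -, -⟩ :=
    NoncompactShrinkerGapCarrilloNiClauses.scalarCurvature_nonneg_and_isCompact_sublevel g f hg hc hf
      hsol hnorm
  exact regularisedVolume_monotone_of_hasDerivAt _
    (fun τ ↦ ∫ x, g.scalarCurvature x * Real.exp (-f x / τ) ∂g.riemVolume)
    (fun τ hτ ↦ regularisedVolume_hasDerivAt g f hg hc hf hsol hnorm hτ)
    (fun τ _ ↦ integral_nonneg fun x ↦ mul_nonneg (hR0 x) (Real.exp_pos _).le)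

end Integrated

/-! ## The registered helper -/

/-- **Helper `helper_regularisedVolume_monotone` of line `Sketch`** (Wang–Wang 2023,
arXiv:2308.06560, Prop. 2.6, first statement, `n = 4`): on every complete connected normalised 4-d
gradient shrinking Ricci soliton the regularised volume `τ ↦ τ⁻² ∫ e^{-f/τ} dV` (`dV` the Riemannian
measure of `g.toContMDiffRiemannianMetric hg`, to which `g.riemVolume` unfolds by `riemVolume_eq`) is
non-decreasing on `(0, 1]` and non-increasing on `[1, ∞)`: `regularisedVolume_monotone_riemVolume`. -/
theorem helper_regularisedVolume_monotone : ∀ (M : Type) [TopologicalSpace M] [T2Space M] [SecondCountableTopology M] [ChartedSpace (EuclideanSpace ℝ (Fin 4)) M] [IsManifold (𝓡 4) ∞ M] [ConnectedSpace M] [T3Space M] [MeasurableSpace M] [BorelSpace M] (g : Literature.Geometry.Lorentzian.PseudoRiemannianMetric (𝓡 4) ∞ (EuclideanSpace ℝ (Fin 4)) (TangentSpace (𝓡 4) : M → Type _)) [g.HasLeviCivita] (f : M → ℝ) (hg : g.IsRiemannian), (∀ (x : M) (r : NNReal), IsCompact {y : M | g.edist hg x y ≤ r}) → ContMDiff (𝓡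 4) 𝓘(ℝ, ℝ) ∞ f → (∀ (x : M) (X Y : TangentSpace (𝓡 4) x), g.ricci x X Y + g.hessian f x X Y = (1 / 2 : ℝ) * g.val x X Y) → (∀ x : M, g.scalarCurvature x + g.gradSq f x = f x) → MonotoneOn (fun τ : ℝ ↦ (τ ^ 2)⁻¹ * ∫ x, Real.exp (-f x / τ) ∂(Literature.Geometry.Lorentzian.riemannianMeasure (g.toContMDiffRiemannianMetric hg))) (Set.Ioc 0 1) ∧ AntitoneOn (fun τ : ℝ ↦ (τ ^ 2)⁻¹ * ∫ x, Real.exp (-f x / τ) ∂(Literature.Geometry.Lorentzian.riemannianMeasure (g.toContMDiffRiemannianMetric hg))) (Set.Ici 1) := by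
  intro M _ _ _ _ _ _ _ _ _ g _ f hg hc hf hsol hnorm
  rw [← PseudoRiemannianMetric.riemVolume_eq hg]
  exact regularisedVolume_monotone_riemVolume g f hg hc hf hsol hnorm

end Summit.SmoothPoincare4.SmoothPoincare4.Theorems.ConicalGapSketch

end
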